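import Summits.SmoothPoincare4.SmoothPoincare4.Theorems.ConvexBisectionAcyclicBisectionExistsHurwitzMoveContract
import Literature.Topology.FourManifolds.IsotopyProofs
import HarnessLib

/-!
# N1 ▸ `node_N1_move` ▸ (c₁) THE FREE SLICE MOVE: the FINAL CONTRACT of design v3,
# `piece_c1_of_pieces (HCORE) (HSEAM) (HISO) : HC1`
(wave 8, brick of stub `stub_M2geo` = node N1 of NF4 ▸ `node_N1_move_of_pieces (HC1) (HC2) (HD) (HE)`
(`…HurwitzMoveContract.lean`) ▸ `HC1`; line `modp-braid-orbits`, crux `ConvexBisection.AcyclicBisectionExists`,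
item stmt-SmoothPoincare4-10508; worker J5, lead c5; design v3 `work/design/N1_SliceMove_Design.lean`;
registered sub-goal `helper_exists_isotopy_comp_stage`)

This file SUPERSEDES the two earlier contracts of the same session (`…SliceMoveContract.lean`:
`piece_c1_of_subpieces`, whose core hypothesis is stated over `(X, h, D)` alone and is therefore not
provable — finding J5-F1: its conclusion forces the boundary page function of `∂X` to be smooth across the
old belt circle, which only the page-certifying `Ψ` guarantees; `…SliceMoveContractK.lean`:
`piece_c1_of_subpieces'`, whose core pins the new circle to the stage `R ψ` of the node's ABSTRACT rigid
rotation).  FINAL form of the three pieces of `HC1` (each true; interfaces minimal):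

* `HCORE` — **the re-digging** over the full fibred datum `(X₀, bX, Ψ, X, G₀, h, D)` (hypotheses of `HC1`
  WITHOUT the rotation `R`): for a free signed angle `ψ` it OUTPUTS an ambient isotopy `R'` of `Base g` and
  a time `τ'` of its own (e.g. G4's sector rotation `helper_rotFlow_sector` at time `ψ` — no comparison with
  a rigid rotation is asked), new attaching maps `h'` and a new datum `D'` of the SAME `X` with `k₀`-th
  circle LITERALLY `R' τ' ∘ K` lying in the page of direction `d k₀ e^{iψ}`, the other circles and framings
  and the page twisting of `k₀` unchanged (`pageTwisting_transport_eq_of_fibred`, p132432's file, or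
  `helper_pageTwisting_transport_rigid`), and the seam/belt DICHOTOMY of `(h', D')` against `(h, D)`.  Route
  (design v3 §1): thin (`helper_exists_thinData`); `M` = sector rotation with angular displacement `a`;
  `σ_t = Ψ̃⁻¹ R⁰_t Ψ̃` the smooth flow on `∂X` raising `θ_X` by `t` (`R⁰` rigid); the boundary shift
  `Γ z = σ_{a (w (β z))} z` (`β` = base coordinate of a seam point, locally constant near the belts); a
  collar extension `Γ̂` (`BoundaryData.nonempty_collar_holds`); `D' = (D₁.transport M).mapDiffeo Γ̂`.
  SIZE XL (1.9–3.1 kLoC).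
* `HSEAM` — **the seam bookkeeping** with the node's `R` (LANDED: `piece_c1_seam`, `…SliceMoveSeam.lean`).
* `HISO` — **the isotopy realisation**: the loop `L'` read back from the `Ψ`-conjugated transport of the
  push-off `L = R ε ∘ K` is AMBIENT ISOTOPIC in `Base g` to the old attaching circle `K`
  (`R₃ τ₃ ∘ L' = K`).  Route (design v3 §3): `t ↦ R_{−tε} ∘ R_{−t(ψ−ε)}`-type reversal of the seam flow
  `σ̃` read on the base, cut off near the loops, collar-extended.  SIZE L (0.8–1.2 kLoC).

Assembly (§2): `X' := X`, `G := refl`, `R₁ := R`, `τ₁ := ε`; the circle clause with the composite isotopy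
of §1 (`helper_exists_isotopy_comp_stage`: an ambient isotopy whose stage `1` is `G u ∘ F s`, here
`R' τ' ∘ R₃ τ₃`); the page clause is `HCORE`'s; the dichotomy through `refl` is `HCORE`'s.
Everything here is proved; the pieces enter as hypotheses; no `sorry`.  References: R. E. Gompf,
A. I. Stipsicz, *4-Manifolds and Kirby Calculus* (1999), §8.2 [GompfStipsicz1999]; M. W. Hirsch,
*Differential Topology* (1976), Ch. 8 §1 [HirschDT1976].
-/

noncomputable section

set_option linter.dupNamespace false

open scoped Manifold ContDiff Topology Real
open Set Function

namespace Summit.SmoothPoincare4.SmoothPoincare4.Theorems.AcyclicBisectionExists.ModpBraidOrbits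

open Literature.GroupTheory.CombinatorialGroupTheory.SignedHurwitz
open Literature.Topology.FourManifolds Literature.Topology.FourManifolds.LefschetzBase
open Literature.Topology.FourManifolds.HandleAttachingMap

/-! ## §1 An ambient isotopy with a prescribed composite stage -/

/-- **Sub-goal `helper_exists_isotopy_comp_stage`** (fully qualified): for ambient isotopies `F`, `G` of
`Base g` and times `s`, `u` there is an ambient isotopy `H` whose stage `1` is `G u ∘ F s` — the stagewise
composite (`AmbientIsotopy.comp`) of the time-rescaled families `t ↦ F (t s)` and `t ↦ G (t u)`.
[cite: HirschDT1976, Ch. 8 §1] -/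
theorem helper_exists_isotopy_comp_stage : ∀ (g : ℕ) (F G : Literature.Topology.FourManifolds.AmbientIsotopy (𝓡∂ 4) (Literature.Topology.FourManifolds.LefschetzBase.Base g)) (s u : ℝ), ∃ H : Literature.Topology.FourManifolds.AmbientIsotopy (𝓡∂ 4) (Literature.Topology.FourManifolds.LefschetzBase.Base g), ∀ x : Literature.Topology.FourManifolds.LefschetzBase.Base g, H.toFun 1 x = G.toFun u (F.toFun s x) := by
  intro g F G s u
  let F' : AmbientIsotopy (𝓡∂ 4) (Base g) :=
    { toFun := fun t => F.toFun (t * s)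
      contMDiff := F.contMDiff.comp
        (((contDiff_id.mul contDiff_const).contMDiff.comp contMDiff_fst).prodMk contMDiff_snd)
      bijective := fun t => F.bijective (t * s)
      isLocalDiffeomorph := fun t => F.isLocalDiffeomorph (t * s)
      map_zero := by
        show F.toFun (0 * s) = id
        rw [zero_mul, F.map_zero] }
  let G' : AmbientIsotopy (𝓡∂ 4) (Base g) :=
    { toFun := fun t => G.toFun (t * u)
      contMDiff := G.contMDiff.comp
        (((contDiff_id.mul contDiff_const).contMDiff.comp contMDiff_fst).prodMk contMDiff_snd)
      bijective := fun t => G.bijective (t * u)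
      isLocalDiffeomorph := fun t => G.isLocalDiffeomorph (t * u)
      map_zero := by
        show G.toFun (0 * u) = id
        rw [zero_mul, G.map_zero] }
  refine ⟨F'.comp G', fun x => ?_⟩
  show G.toFun (1 * u) (F.toFun (1 * s) x) = G.toFun u (F.toFun s x)
  rw [one_mul, one_mul]

/-! ## §2 The final contract `HC1 ⇐ (core) ∧ (seam) ∧ (iso)` -/

set_option maxHeartbeats 800000 in
-- three ∀-texts of 40–45 binders each as hypotheses and a 21-component witness
/-- **Piece (c₁) `HC1` of `node_N1_move_of_pieces` from its three pieces, FINAL form of design v3**: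
`HCORE` the re-digging over the full fibred datum with an ambient isotopy `R'` and a time `τ'` of its own
(new datum of the same `X`, `k₀`-th circle `R' τ' ∘ K` in the page of direction `d k₀ e^{iψ}`, other
circles, framings and the page twisting of `k₀` unchanged,
seam/belt dichotomy against `(h, D)`), `HSEAM` the seam bookkeeping with the node's rotation `R` (landed as
`piece_c1_seam`), `HISO` the isotopy realisation `R₃ τ₃ ∘ L' = K`.  The conclusion is the text of `HC1`
VERBATIM; witnesses `X' := X`, `G := refl`, `R₁ := R`, `τ₁ := ε`, and for the circle clause the composite
isotopy with stage `R' τ' ∘ R₃ τ₃` at time `1`. [cite: GompfStipsicz1999, §8.2] -/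
theorem piece_c1_of_pieces
    (HCORE : ∀ (g n : ℕ) (X₀ : Type) [TopologicalSpace X₀] [T2Space X₀] [SecondCountableTopology X₀] [CompactSpace X₀] [ChartedSpace (EuclideanHalfSpace 4) X₀] [IsManifold (𝓡∂ 4) ∞ X₀] (bX : BoundaryData (𝓡∂ 4) X₀ (𝓡 3)) (Ψ : bX.carrier ≃ₘ⟮𝓡 3, 𝓡 3⟯ (bBase g).carrier) (X : Type) [TopologicalSpace X] [T2Space X] [SecondCountableTopology X] [CompactSpace X] [ChartedSpace (EuclideanHalfSpace 4) X] [IsManifold (𝓡∂ 4) ∞ X] (G₀ : X₀ ≃ₘ⟮𝓡∂ 4, 𝓡∂ 4⟯ X) (h : Fin n → HandleAttachingMap 3 2 (Base g)) (D : MultiAttachmentData h (𝓡∂ 4) X) (d : Fin n → ℂ), (∀ k, ‖d k‖ = 1) → (∀ k θ, (h k).attachingCircle θ ∈ page g (d k)) → (∀ (y : bX.carrier) (a : ↥(coresComplement h)), G₀ (bX.incl y) = D.jA a → ∃ c : ℝ, 0 < c ∧ w g ((bBase g).incl (Ψ y)).1 = (c : ℂ) * w g (a : Base g).1) → (∀ (y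 : bX.carrier) (k : Fin n) (b : ↥(beltPiece 3 2)), G₀ (bX.incl y) = D.jB k b → G₀ (bX.incl y) ∉ range D.jA → ∃ c : ℝ, 0 < c ∧ w g ((bBase g).incl (Ψ y)).1 = (c : ℂ) * d k) → ∀ (k₀ : Fin n) (ψ : ℝ), ψ ≠ 0 → |ψ| < 2 * π → (∀ k, k ≠ k₀ → ∀ t ∈ Set.Icc (0 : ℝ) 1, d k ≠ d k₀ * Complex.exp (((t * ψ : ℝ) : ℂ) * Complex.I)) → ∃ (R' : AmbientIsotopy (𝓡∂ 4) (Base g)) (τ' : ℝ) (h' : Fin n → HandleAttachingMap 3 2 (Base g)) (D' : MultiAttachmentData h' (𝓡∂ 4) X), (∀ θ, (h' k₀).attachingCircle θ = R'.toFun τ' ((h k₀).attachingCircle θ)) ∧ (∀ θ, (h' k₀).attachingCircle θ ∈ page g (d k₀ * Complex.exp ((ψ : ℂ) * Complex.I))) ∧ (∀ k, k ≠ k₀ → (h' k).attachingCircle = (h k).attachingCircle ∧ (h' k).attachingFraming = (h k).attachingFraming) ∧ pageTwisting g (h' k₀).attachingCircle (h' k₀).attachingFraming = pageTwisting g (h k₀).attachingCircle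 (h k₀).attachingFraming ∧ (∀ a' : ↥(coresComplement h'), D'.jA a' ∈ (𝓡∂ 4).boundary X → (∃ a : ↥(coresComplement h), D'.jA a' = D.jA a ∧ ∃ c : ℝ, 0 < c ∧ w g (a' : Base g).1 = (c : ℂ) * w g (a : Base g).1) ∨ (∃ (k : Fin n) (b : ↥(beltPiece 3 2)), D'.jA a' = D.jB k b ∧ D'.jA a' ∉ range D.jA ∧ ∃ c : ℝ, 0 < c ∧ w g (a' : Base g).1 = (c : ℂ) * d k)) ∧ (∀ (k' : Fin n) (b' : ↥(beltPiece 3 2)), D'.jB k' b' ∉ range D'.jA → D'.jB k' b' ∈ (𝓡∂ 4).boundary X → (∃ a : ↥(coresComplement h), D'.jB k' b' = D.jA a ∧ ∃ c : ℝ, 0 < c ∧ w g (a : Base g).1 = (c : ℂ) * Function.update d k₀ (d k₀ * Complex.exp ((ψ : ℂ) * Complex.I)) k') ∨ (∃ (k : Fin n) (b : ↥(beltPiece 3 2)), D'.jB k' b' = D.jB k b ∧ D'.jB k' b' ∉ range D.jA ∧ d k = Function.update d k₀ (d k₀ * Complex.exp ((ψ : ℂ) * Complex.I)) k')))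
    (HSEAM : ∀ (g n : ℕ) (X₀ : Type) [TopologicalSpace X₀] [T2Space X₀] [SecondCountableTopology X₀] [CompactSpace X₀] [ChartedSpace (EuclideanHalfSpace 4) X₀] [IsManifold (𝓡∂ 4) ∞ X₀] (bX : BoundaryData (𝓡∂ 4) X₀ (𝓡 3)) (Ψ : bX.carrier ≃ₘ⟮𝓡 3, 𝓡 3⟯ (bBase g).carrier) (X : Type) [TopologicalSpace X] [T2Space X] [SecondCountableTopology X] [CompactSpace X] [ChartedSpace (EuclideanHalfSpace 4) X] [IsManifold (𝓡∂ 4) ∞ X] (G₀ : X₀ ≃ₘ⟮𝓡∂ 4, 𝓡∂ 4⟯ X) (h : Fin n → HandleAttachingMap 3 2 (Base g)) (D : MultiAttachmentData h (𝓡∂ 4) X) (d : Fin n → ℂ), (∀ k, ‖d k‖ = 1) → (∀ k θ, (h k).attachingCircle θ ∈ page g (d k)) → (∀ (y : bX.carrier) (a : ↥(coresComplement h)), G₀ (bX.incl y) = D.jA a → ∃ c : ℝ, 0 < c ∧ w g ((bBase g).incl (Ψ y)).1 = (c : ℂ) * w g (a : Base g).1) → (∀ (y : bX.carrier) (k : Fin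 n) (b : ↥(beltPiece 3 2)), G₀ (bX.incl y) = D.jB k b → G₀ (bX.incl y) ∉ range D.jA → ∃ c : ℝ, 0 < c ∧ w g ((bBase g).incl (Ψ y)).1 = (c : ℂ) * d k) → ∀ (k₀ : Fin n) (ψ : ℝ) (R : AmbientIsotopy (𝓡∂ 4) (Base g)), ψ ≠ 0 → |ψ| < 2 * π → (∀ (t : ℝ) (x : Base g), rho g (R.toFun t x).1 = rho g x.1) → (∀ (t : ℝ) (x : Base g), w g (R.toFun t x).1 = Complex.exp ((t : ℂ) * Complex.I) * w g x.1) → (∀ (t : ℝ) (x : Base g), ‖cx (R.toFun t x).1‖ ^ 2 < 4 ↔ ‖cx x.1‖ ^ 2 < 4) → (∀ (t t' : ℝ) (x : Base g), R.toFun t (R.toFun t' x) = R.toFun (t + t') x) → (∀ k, k ≠ k₀ → ∀ t ∈ Set.Icc (0 : ℝ) 1, d k ≠ d k₀ * Complex.exp (((t * ψ : ℝ) : ℂ) * Complex.I)) → ∃ (ε : ℝ) (L L' : Metric.sphere (0 : EuclideanSpace ℝ (Fin 2)) 1 → Base g) (y y' : Metric.sphere (0 : EuclideanSpace ℝ (Fin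 2)) 1 → bX.carrier) (a a' : Metric.sphere (0 : EuclideanSpace ℝ (Fin 2)) 1 → ↥(coresComplement h)), (0 < ε / ψ ∧ ε / ψ < 1) ∧ Continuous L ∧ Continuous L' ∧ (∀ θ, L θ = R.toFun ε ((h k₀).attachingCircle θ)) ∧ (∀ θ, L θ ∈ page g (d k₀ * Complex.exp ((ε : ℂ) * Complex.I))) ∧ (∀ θ, G₀ (bX.incl (y θ)) = D.jA (a θ)) ∧ (∀ θ, ((a θ : ↥(coresComplement h)) : Base g) = L θ) ∧ (∀ θ, (bBase g).incl (Ψ (y' θ)) = R.toFun (ψ - ε) ((bBase g).incl (Ψ (y θ)))) ∧ (∀ θ, G₀ (bX.incl (y' θ)) = D.jA (a' θ)) ∧ (∀ θ, ((a' θ : ↥(coresComplement h)) : Base g) = L' θ))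
    (HISO : ∀ (g n : ℕ) (X₀ : Type) [TopologicalSpace X₀] [T2Space X₀] [SecondCountableTopology X₀] [CompactSpace X₀] [ChartedSpace (EuclideanHalfSpace 4) X₀] [IsManifold (𝓡∂ 4) ∞ X₀] (bX : BoundaryData (𝓡∂ 4) X₀ (𝓡 3)) (Ψ : bX.carrier ≃ₘ⟮𝓡 3, 𝓡 3⟯ (bBase g).carrier) (X : Type) [TopologicalSpace X] [T2Space X] [SecondCountableTopology X] [CompactSpace X] [ChartedSpace (EuclideanHalfSpace 4) X] [IsManifold (𝓡∂ 4) ∞ X] (G₀ : X₀ ≃ₘ⟮𝓡∂ 4, 𝓡∂ 4⟯ X) (h : Fin n → HandleAttachingMap 3 2 (Base g)) (D : MultiAttachmentData h (𝓡∂ 4) X) (d : Fin n → ℂ), (∀ k, ‖d k‖ = 1) → (∀ k θ, (h k).attachingCircle θ ∈ page g (d k)) → (∀ (y : bX.carrier) (a : ↥(coresComplement h)), G₀ (bX.incl y) = D.jA a → ∃ c : ℝ, 0 < c ∧ w g ((bBase g).incl (Ψ y)).1 = (c : ℂ) * w g (a : Base g).1) → (∀ (y : bX.carrier) (k : Fin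 n) (b : ↥(beltPiece 3 2)), G₀ (bX.incl y) = D.jB k b → G₀ (bX.incl y) ∉ range D.jA → ∃ c : ℝ, 0 < c ∧ w g ((bBase g).incl (Ψ y)).1 = (c : ℂ) * d k) → ∀ (k₀ : Fin n) (ψ : ℝ) (R : AmbientIsotopy (𝓡∂ 4) (Base g)), ψ ≠ 0 → |ψ| < 2 * π → (∀ (t : ℝ) (x : Base g), rho g (R.toFun t x).1 = rho g x.1) → (∀ (t : ℝ) (x : Base g), w g (R.toFun t x).1 = Complex.exp ((t : ℂ) * Complex.I) * w g x.1) → (∀ (t : ℝ) (x : Base g), ‖cx (R.toFun t x).1‖ ^ 2 < 4 ↔ ‖cx x.1‖ ^ 2 < 4) → (∀ (t t' : ℝ) (x : Base g), R.toFun t (R.toFun t' x) = R.toFun (t + t') x) → (∀ k, k ≠ k₀ → ∀ t ∈ Set.Icc (0 : ℝ) 1, d k ≠ d k₀ * Complex.exp (((t * ψ : ℝ) : ℂ) * Complex.I)) → ∀ (ε : ℝ) (L L' : Metric.sphere (0 : EuclideanSpace ℝ (Fin 2)) 1 → Base g) (y y' : Metric.sphere (0 : EuclideanSpace ℝ (Fin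 2)) 1 → bX.carrier) (a a' : Metric.sphere (0 : EuclideanSpace ℝ (Fin 2)) 1 → ↥(coresComplement h)), (0 < ε / ψ ∧ ε / ψ < 1) → (∀ θ, L θ = R.toFun ε ((h k₀).attachingCircle θ)) → (∀ θ, G₀ (bX.incl (y θ)) = D.jA (a θ)) → (∀ θ, ((a θ : ↥(coresComplement h)) : Base g) = L θ) → (∀ θ, (bBase g).incl (Ψ (y' θ)) = R.toFun (ψ - ε) ((bBase g).incl (Ψ (y θ)))) → (∀ θ, G₀ (bX.incl (y' θ)) = D.jA (a' θ)) → (∀ θ, ((a' θ : ↥(coresComplement h)) : Base g) = L' θ) → ∃ (R₃ : AmbientIsotopy (𝓡∂ 4) (Base g)) (τ₃ : ℝ), ∀ θ, R₃.toFun τ₃ (L' θ) = (h k₀).attachingCircle θ) :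
    ∀ (g n : ℕ) (X₀ : Type) [TopologicalSpace X₀] [T2Space X₀] [SecondCountableTopology X₀] [CompactSpace X₀] [ChartedSpace (EuclideanHalfSpace 4) X₀] [IsManifold (𝓡∂ 4) ∞ X₀] (bX : BoundaryData (𝓡∂ 4) X₀ (𝓡 3)) (Ψ : bX.carrier ≃ₘ⟮𝓡 3, 𝓡 3⟯ (bBase g).carrier) (X : Type) [TopologicalSpace X] [T2Space X] [SecondCountableTopology X] [CompactSpace X] [ChartedSpace (EuclideanHalfSpace 4) X] [IsManifold (𝓡∂ 4) ∞ X] (G₀ : X₀ ≃ₘ⟮𝓡∂ 4, 𝓡∂ 4⟯ X) (h : Fin n → HandleAttachingMap 3 2 (Base g)) (D : MultiAttachmentData h (𝓡∂ 4) X) (d : Fin n → ℂ), (∀ k, ‖d k‖ = 1) → (∀ k θ, (h k).attachingCircle θ ∈ page g (d k)) → (∀ (y : bX.carrier) (a : ↥(coresComplement h)), G₀ (bX.incl y) = D.jA a → ∃ c : ℝ, 0 < c ∧ w g ((bBase g).incl (Ψ y)).1 = (c : ℂ) * w g (a : Base g).1) → (∀ (y : bX.carrier) (k : Fin n) (b :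 ↥(beltPiece 3 2)), G₀ (bX.incl y) = D.jB k b → G₀ (bX.incl y) ∉ range D.jA → ∃ c : ℝ, 0 < c ∧ w g ((bBase g).incl (Ψ y)).1 = (c : ℂ) * d k) → ∀ (k₀ : Fin n) (ψ : ℝ) (R : AmbientIsotopy (𝓡∂ 4) (Base g)), ψ ≠ 0 → |ψ| < 2 * π → (∀ (t : ℝ) (x : Base g), rho g (R.toFun t x).1 = rho g x.1) → (∀ (t : ℝ) (x : Base g), w g (R.toFun t x).1 = Complex.exp ((t : ℂ) * Complex.I) * w g x.1) → (∀ (t : ℝ) (x : Base g), ‖cx (R.toFun t x).1‖ ^ 2 < 4 ↔ ‖cx x.1‖ ^ 2 < 4) → (∀ (t t' : ℝ) (x : Base g), R.toFun t (R.toFun t' x) = R.toFun (t + t') x) → (∀ k, k ≠ k₀ → ∀ t ∈ Set.Icc (0 : ℝ) 1, d k ≠ d k₀ * Complex.exp (((t * ψ : ℝ) : ℂ) * Complex.I)) → ∃ (X' : Type) (_ : TopologicalSpace X') (_ : T2Space X') (_ : SecondCountableTopology X') (_ : CompactSpace X') (_ : ChartedSpace (EuclideanHalfSpace 4) X') (_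 : IsManifold (𝓡∂ 4) ∞ X') (h' : Fin n → HandleAttachingMap 3 2 (Base g)) (D' : MultiAttachmentData h' (𝓡∂ 4) X') (G : X ≃ₘ⟮𝓡∂ 4, 𝓡∂ 4⟯ X') (R₁ R₃ : AmbientIsotopy (𝓡∂ 4) (Base g)) (τ₁ τ₃ ε : ℝ) (L L' : Metric.sphere (0 : EuclideanSpace ℝ (Fin 2)) 1 → Base g) (y y' : Metric.sphere (0 : EuclideanSpace ℝ (Fin 2)) 1 → bX.carrier) (a a' : Metric.sphere (0 : EuclideanSpace ℝ (Fin 2)) 1 → ↥(coresComplement h)), (0 < ε / ψ ∧ ε / ψ < 1) ∧ Continuous L ∧ Continuous L' ∧ (∀ θ, L θ = R₁.toFun τ₁ ((h k₀).attachingCircle θ)) ∧ (∀ θ, L θ ∈ page g (d k₀ * Complex.exp ((ε : ℂ) * Complex.I))) ∧ (∀ θ, G₀ (bX.incl (y θ)) = D.jA (a θ)) ∧ (∀ θ, ((a θ : ↥(coresComplement h)) : Base g) = L θ) ∧ (∀ θ, (bBase g).incl (Ψ (y' θ)) = R.toFun (ψ - ε) ((bBase g).incl (Ψ (y θ)))) ∧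 (∀ θ, G₀ (bX.incl (y' θ)) = D.jA (a' θ)) ∧ (∀ θ, ((a' θ : ↥(coresComplement h)) : Base g) = L' θ) ∧ (∀ θ, (h' k₀).attachingCircle θ = R₃.toFun τ₃ (L' θ)) ∧ (∀ θ, (h' k₀).attachingCircle θ ∈ page g (d k₀ * Complex.exp ((ψ : ℂ) * Complex.I))) ∧ (∀ k, k ≠ k₀ → (h' k).attachingCircle = (h k).attachingCircle ∧ (h' k).attachingFraming = (h k).attachingFraming) ∧ pageTwisting g (h' k₀).attachingCircle (h' k₀).attachingFraming = pageTwisting g (h k₀).attachingCircle (h k₀).attachingFraming ∧ (∀ a' : ↥(coresComplement h'), G.symm (D'.jA a') ∈ (𝓡∂ 4).boundary X → (∃ a : ↥(coresComplement h), G.symm (D'.jA a') = D.jA a ∧ ∃ c : ℝ, 0 < c ∧ w g (a' : Base g).1 = (c : ℂ) * w g (a : Base g).1) ∨ (∃ (k : Fin n) (b : ↥(beltPiece 3 2)), G.symm (D'.jA a') = D.jB k b ∧ G.symm (D'.jA a') ∉ range D.jA ∧ ∃ c : ℝ, 0 < c ∧ w g (a' : Base g).1 = (c : ℂ) * d k))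 ∧ (∀ (k' : Fin n) (b' : ↥(beltPiece 3 2)), D'.jB k' b' ∉ range D'.jA → G.symm (D'.jB k' b') ∈ (𝓡∂ 4).boundary X → (∃ a : ↥(coresComplement h), G.symm (D'.jB k' b') = D.jA a ∧ ∃ c : ℝ, 0 < c ∧ w g (a : Base g).1 = (c : ℂ) * Function.update d k₀ (d k₀ * Complex.exp ((ψ : ℂ) * Complex.I)) k') ∨ (∃ (k : Fin n) (b : ↥(beltPiece 3 2)), G.symm (D'.jB k' b') = D.jB k b ∧ G.symm (D'.jB k' b') ∉ range D.jA ∧ d k = Function.update d k₀ (d k₀ * Complex.exp ((ψ : ℂ) * Complex.I)) k')) := by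
  intro g n X₀ _ _ _ _ _ _ bX Ψ X _ _ _ _ _ _ G₀ h D d hd hpg hseam hbelt k₀ ψ R hψ0 hψ hRρ hRw hRcx hRflow
    hfree
  obtain ⟨R', τ', h', D', hcirc, hpg', hothers, htw, hO1, hO2⟩ :=
    HCORE g n X₀ bX Ψ X G₀ h D d hd hpg hseam hbelt k₀ ψ hψ0 hψ hfree
  obtain ⟨ε, L, L', y, y', a, a', hε, hLc, hL'c, hL, hLp, hy, ha, hrel, hy', ha'⟩ :=
    HSEAM g n X₀ bX Ψ X G₀ h D d hd hpg hseam hbelt k₀ ψ R hψ0 hψ hRρ hRw hRcx hRflow hfree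
  obtain ⟨R₃, τ₃, hiso⟩ :=
    HISO g n X₀ bX Ψ X G₀ h D d hd hpg hseam hbelt k₀ ψ R hψ0 hψ hRρ hRw hRcx hRflow hfree ε L L' y y'
      a a' hε hL hy ha hrel hy' ha'
  obtain ⟨H, hH⟩ := helper_exists_isotopy_comp_stage g R₃ R' τ₃ τ'
  refine ⟨X, inferInstance, inferInstance, inferInstance, inferInstance, inferInstance, inferInstance,
    h', D', Diffeomorph.refl (𝓡∂ 4) X ∞, R, H, ε, 1, ε, L, L', y, y', a, a', hε, hLc, hL'c, hL, hLp,
    hy, ha, hrel, hy', ha', fun θ => ?_, hpg', hothers, htw, fun a' ha' => hO1 a' ha',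
    fun k' b' hdeep hb => hO2 k' b' hdeep hb⟩
  rw [hcirc θ, hH, hiso θ]

end Summit.SmoothPoincare4.SmoothPoincare4.Theorems.AcyclicBisectionExists.ModpBraidOrbits

end
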